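import Summits.MatrixMultiplication.OmegaCensus.SmallFormats.MatMul227GF3FootprintBlocks
import Summits.MatrixMultiplication.OmegaCensus.SmallFormats.KroneckerBlocks
import Summits.MatrixMultiplication.OmegaCensus.SmallFormats.KroneckerEnum97

/-!
# Kronecker modules IX: flattening a block list — offsets, the entries of the block pencil, `KBlock (ZMod 3) → PBlock`

Cell `pub-omega` (unit `pub-omega-tensor-g33`), topic `Summits/MatrixMultiplication/OmegaCensus` (sub-folder `SmallFormats`).
Framing (verbatim): lottery ticket; floor = certified bounds/negative ranges. HONEST FRAMING: index bookkeeping for the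
derivation of `KroneckerBlockForm97`; nothing on `ω` here.

`rowOff l j` / `colOff l j` = number of rows / columns of the first `j` blocks; `bsEntry_rowOff` computes the block pencil's
entry in row `rowOff l j + r` (the `r`-th row of block `j`): it is block `j`'s entry at the local column, and `0` outside
block `j`'s columns. `colBlock l m` = (block, local column) of the global column `m` (`colBlock_colOff`, `colBlock_spec`).
`toP : KBlock (ZMod 3) → PBlock` (coefficients ↦ `ZMod.val`) preserves shapes and, after the cast `ℕ → ZMod 3`, entries
(`cast_a_toP`, `cast_b_toP`); proper blocks other than `L 0`, `LT 0` map to admissible ones (`adm_toP`).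
-/

namespace Summit.MatrixMultiplication.OmegaCensus.SmallFormats

open Kronecker

namespace KroneckerFlat

/-! ## Offsets and the entries of a block pencil -/

/-- Rows before block `j`. -/
def rowOff (l : List PBlock) (j : ℕ) : ℕ := totRows (l.take j)

/-- Columns before block `j`. -/
def colOff (l : List PBlock) (j : ℕ) : ℕ := totCols (l.take j)

/-- `totRows` of a cons. -/
@[simp] theorem totRows_cons (B : PBlock) (l : List PBlock) : totRows (B :: l) = B.rows + totRows l := by
  simp [totRows]

/-- `totCols` of a cons. -/
@[simp] theorem totCols_cons (B : PBlock) (l : List PBlock) : totCols (B :: l) = B.cols + totCols l := by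
  simp [totCols]

/-- `totRows [] = 0`. -/
@[simp] theorem totRows_nil : totRows [] = 0 := rfl

/-- `totCols [] = 0`. -/
@[simp] theorem totCols_nil : totCols [] = 0 := rfl

/-- `rowOff` at `0`. -/
@[simp] theorem rowOff_zero (l : List PBlock) : rowOff l 0 = 0 := by simp [rowOff]

/-- `colOff` at `0`. -/
@[simp] theorem colOff_zero (l : List PBlock) : colOff l 0 = 0 := by simp [colOff]

/-- `rowOff` of a cons at a successor. -/
@[simp] theorem rowOff_cons_succ (B : PBlock) (l : List PBlock) (j : ℕ) : rowOff (B :: l) (j + 1) = B.rows + rowOff l j := by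
  simp [rowOff]

/-- `colOff` of a cons at a successor. -/
@[simp] theorem colOff_cons_succ (B : PBlock) (l : List PBlock) (j : ℕ) : colOff (B :: l) (j + 1) = B.cols + colOff l j := by
  simp [colOff]

/-- `rowOff l j + rows of block j ≤ totRows l`. -/
theorem rowOff_add_rows_le : ∀ (l : List PBlock) (j : ℕ) (hj : j < l.length), rowOff l j + (l[j]).rows ≤ totRows l
  | [], j, hj => absurd hj (Nat.not_lt_zero _)
  | B :: l, 0, _ => by simp
  | B :: l, j + 1, hj => by
      have := rowOff_add_rows_le l j (by simpa using hj)
      simp only [rowOff_cons_succ, List.getElem_cons_succ, totRows_cons]; omega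

/-- `colOff l j + cols of block j ≤ totCols l`. -/
theorem colOff_add_cols_le : ∀ (l : List PBlock) (j : ℕ) (hj : j < l.length), colOff l j + (l[j]).cols ≤ totCols l
  | [], j, hj => absurd hj (Nat.not_lt_zero _)
  | B :: l, 0, _ => by simp
  | B :: l, j + 1, hj => by
      have := colOff_add_cols_le l j (by simpa using hj)
      simp only [colOff_cons_succ, List.getElem_cons_succ, totCols_cons]; omega

/-- **Entries of the block pencil**: in row `rowOff l j + r` (`r <` rows of block `j`) the entry at global column `m` is block
`j`'s entry at the local column `m - colOff l j` inside block `j`'s columns and `0` outside. -/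
theorem bsEntry_rowOff (F : PBlock → ℕ → ℕ → ℕ) :
    ∀ (l : List PBlock) (j : ℕ) (hj : j < l.length) (r : ℕ) (_ : r < (l[j]).rows) (m : ℕ),
      bsEntry F l (rowOff l j + r) m =
        if colOff l j ≤ m ∧ m < colOff l j + (l[j]).cols then F l[j] r (m - colOff l j) else 0
  | [], j, hj, _, _, _ => absurd hj (Nat.not_lt_zero _)
  | B :: l, 0, _, r, hr, m => by
      simp only [rowOff_zero, colOff_zero, Nat.zero_add, List.getElem_cons_zero, Nat.zero_le, true_and, Nat.sub_zero] at hr ⊢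
      simp [bsEntry, hr]
  | B :: l, j + 1, hj, r, hr, m => by
      have hj' : j < l.length := by simpa using hj
      simp only [List.getElem_cons_succ] at hr ⊢
      rw [rowOff_cons_succ, colOff_cons_succ, bsEntry, if_neg (by omega), Nat.add_assoc, Nat.add_sub_cancel_left,
        bsEntry_rowOff F l j hj' r hr]
      by_cases hm : m < B.cols
      · rw [if_pos hm, if_neg (by omega)]
      · rw [if_neg hm]
        by_cases h2 : colOff l j ≤ m - B.cols ∧ m - B.cols < colOff l j + (l[j]).cols
        · rw [if_pos h2, if_pos (by omega), show m - B.cols - colOff l j = m - (B.cols + colOff l j) by omega]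
        · rw [if_neg h2, if_neg (by omega)]

/-! ## Global column ↦ (block, local column) -/

/-- The block index and local column of a global column. -/
def colBlock : List PBlock → ℕ → ℕ × ℕ
  | [], m => (0, m)
  | B :: l, m => if m < B.cols then (0, m) else ((colBlock l (m - B.cols)).1 + 1, (colBlock l (m - B.cols)).2)

/-- `colBlock` inverts `(j, c) ↦ colOff l j + c`. -/
theorem colBlock_colOff : ∀ (l : List PBlock) (j : ℕ) (hj : j < l.length) (c : ℕ) (_ : c < (l[j]).cols),
    colBlock l (colOff l j + c) = (j, c)
  | [], j, hj, _, _ => absurd hj (Nat.not_lt_zero _)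
  | B :: l, 0, _, c, hc => by
      simp only [List.getElem_cons_zero] at hc
      simp [colBlock, hc]
  | B :: l, j + 1, hj, c, hc => by
      simp only [List.getElem_cons_succ] at hc
      rw [colOff_cons_succ, colBlock, if_neg (by omega), Nat.add_assoc, Nat.add_sub_cancel_left,
        colBlock_colOff l j (by simpa using hj) c hc]

/-- The block and local column of a global column `m < totCols l` are in range and recover `m`. -/
theorem colBlock_spec : ∀ (l : List PBlock) (m : ℕ) (_ : m < totCols l),
    (colBlock l m).1 < l.length ∧ ∃ h : (colBlock l m).1 < l.length,
      (colBlock l m).2 < (l[(colBlock l m).1]).cols ∧ colOff l (colBlock l m).1 + (colBlock l m).2 = m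
  | [], m, hm => absurd hm (by simp)
  | B :: l, m, hm => by
      rw [totCols_cons] at hm
      by_cases h : m < B.cols
      · refine ⟨by simp [colBlock, h], by simp [colBlock, h], ?_⟩
        simp [colBlock, h]
      · obtain ⟨h1, h1', h2, h3⟩ := colBlock_spec l (m - B.cols) (by omega)
        refine ⟨by simp [colBlock, h, h1], by simp [colBlock, h, h1], ?_⟩
        simp only [colBlock, h, if_false, List.getElem_cons_succ, colOff_cons_succ]
        exact ⟨h2, by omega⟩

/-! ## `KBlock (ZMod 3) → PBlock` -/

/-- The `PBlock` of a `KBlock (ZMod 3)` (coefficients by `ZMod.val`). -/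
def toP : KBlock (ZMod 3) → PBlock
  | .L e => .L e
  | .LT e => .LT e
  | .N u => .N u
  | .C c => .C (c.map ZMod.val)

/-- `toP` preserves rows. -/
@[simp] theorem rows_toP (B : KBlock (ZMod 3)) : (toP B).rows = B.rows := by
  cases B <;> simp [toP, PBlock.rows, KBlock.rows]

/-- `toP` preserves columns. -/
@[simp] theorem cols_toP (B : KBlock (ZMod 3)) : (toP B).cols = B.cols := by
  cases B <;> simp [toP, PBlock.cols, KBlock.cols]

/-- The base-3 complement digit is the negative in `ZMod 3`. -/
theorem cast_negDigit (v : ZMod 3) : (((3 - v.val % 3) % 3 : ℕ) : ZMod 3) = -v := by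
  revert v; decide

/-- `A`-entries: `PBlock.a (toP B)` casts to `KBlock.A B`. -/
theorem cast_a_toP (B : KBlock (ZMod 3)) (i j : ℕ) : (((toP B).a i j : ℕ) : ZMod 3) = B.A i j := by
  cases B with
  | L e => simp only [toP, PBlock.a, KBlock.A]; split_ifs <;> simp
  | LT e => simp only [toP, PBlock.a, KBlock.A]; split_ifs <;> simp
  | N u => simp only [toP, PBlock.a, KBlock.A]; split_ifs <;> simp
  | C c =>
      simp only [toP, PBlock.a, KBlock.A, List.length_map]
      split_ifs with h1 h2
      · rw [show (0 : ℕ) = ZMod.val (0 : ZMod 3) from rfl, List.getD_map, cast_negDigit]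
      · simp
      · simp

/-- `B`-entries: `PBlock.b (toP B)` casts to `KBlock.B B`. -/
theorem cast_b_toP (B : KBlock (ZMod 3)) (i j : ℕ) : (((toP B).b i j : ℕ) : ZMod 3) = B.B i j := by
  cases B <;> simp only [toP, PBlock.b, KBlock.B] <;> split_ifs <;> simp

/-- A proper block (positive size) other than `L 0`, `LT 0` maps to an admissible `PBlock`. -/
theorem adm_toP (B : KBlock (ZMod 3)) (hpos : 0 < B.rows + B.cols) (hL : B ≠ .L 0) (hLT : B ≠ .LT 0) :
    (toP B).adm = true := by
  cases B with
  | L e => simp only [toP, PBlock.adm, decide_eq_true_eq]; by_contra h; exact hL (by congr; omega)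
  | LT e => simp only [toP, PBlock.adm, decide_eq_true_eq]; by_contra h; exact hLT (by congr; omega)
  | N u => simp only [KBlock.rows, KBlock.cols] at hpos; simp only [toP, PBlock.adm, decide_eq_true_eq]; omega
  | C c =>
      simp only [KBlock.rows, KBlock.cols] at hpos
      simp only [toP, PBlock.adm, Bool.and_eq_true, decide_eq_true_eq, List.all_eq_true, List.mem_map, ne_eq,
        List.map_eq_nil_iff]
      refine ⟨fun h => by simp [h] at hpos, ?_⟩
      rintro _ ⟨v, _, rfl⟩
      exact ZMod.val_lt v

/-- Key of a sorted tuple: `List.ofFn` of a composition with `Tuple.sort` is `Pairwise` non-decreasing. -/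
theorem pairwise_key_ofFn_sort {n : ℕ} (g : Fin n → PBlock) :
    (List.ofFn (fun j => g (Tuple.sort (fun i => (g i).key) j))).Pairwise (fun B B' => B.key ≤ B'.key) := by
  rw [List.pairwise_ofFn]
  intro i j hij
  exact Tuple.monotone_sort (fun i => (g i).key) hij.le

end KroneckerFlat

end Summit.MatrixMultiplication.OmegaCensus.SmallFormats
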